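import Mathlib
import Summits.KontsevichZagierPeriods.KontsevichZagierPeriods.Theorems.TorsionLogsGKZLevelThreePairBetaCubic

/-!
# Route TorsionLogs — support item `GKZLevelThreePair`: the logarithmic tail of the T-chain
# (`[(0,1), 9/((2-r)(1+r))] ∼ [(1,2), 6/x]`, value `6 log 2`)

Helper file for item `stmt-KontsevichZagierPeriods-13812` (`GKZLevelThreePair`), steps (M7)–(M8) of
the prover's blueprint v2 (item evidence `blueprint-13812-v2.md`). There the 2-dimensional factor
`Trep = [(0,1)², k(t, 1-2y²)]` of the level-3 Euler representation (value `T = 6 log 2`) is carried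
by explicit moves to the rational representation `[(0,1), 9/((2-r)(1+r))]`; this file finishes that
chain inside the Kontsevich–Zagier calculus:

* `ratTail_equivalent_L6` — `[(0,1), 9/((2-r)(1+r))] ∼ [(1,2), 6/x]`: partial fractions
  `9/((2-r)(1+r)) = 3/(2-r) + 3/(1+r)` (rule 1b)), the substitutions `x = 2 - r`, `x = 1 + r`
  (rule 2)) onto `(1,2)`, and `3/x + 3/x = 6/x` (rule 1b));
* `invTail_equivalent_ratTail` — `[(2,∞), 9/((v-1)(v+2))] ∼ [(0,1), 9/((2-r)(1+r))]` by `v = 2/r`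
  (rule 2)), step (M6)→(M7).

All representations are PINNED by their domain and their integrand on it.

## References

* M. Kontsevich, D. Zagier, *Periods* (2001), §1.1 (`log 2 = ∫₁² dx/x`), §1.2 rules (1), (2).
-/

-- `Summit.<Summit>.<Sub>` with Sub = Summit (single-conjunct summit, D-0017) duplicates the segment.
set_option linter.dupNamespace false

noncomputable section

namespace Summit.KontsevichZagierPeriods.KontsevichZagierPeriods.Theorems.GKZLevelThree

open Set MeasureTheory
open MvPolynomial (aeval X C)
open Literature.NumberTheory.Transcendental Literature.NumberTheory.Transcendental.KZ
open Literature.ModelTheory.ExponentialFields (IsSemialgebraic isSemialgebraic_setOf_eval_pos)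
open Summit.KontsevichZagierPeriods.HermiteRigidity.CMTwistQuasiPeriodTransfer
  (of_sub_of_mem_changeOfVariablesRel_dimOne)

/-! ## Interval representations with rational integrands -/

/-- `[(1,2), c/x]` exists for rational `c`. -/
theorem exists_L (c : ℚ) : ∃ L : IntegralRep 1, L.domain = {x : Fin 1 → ℝ | 1 < x 0 ∧ x 0 < 2} ∧
    L.integrand = fun x => (c : ℝ) / x 0 := by
  have h2 : IsAlgebraic ℚ (2:ℝ) := by simpa using isAlgebraic_nat (R := ℚ) (A := ℝ) 2
  have hc : ContinuousOn (fun x : ℝ => (c : ℝ) / x) (Icc 1 2) :=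
    continuousOn_const.div continuousOn_id fun x hx => by
      have h1 : (1:ℝ) ≤ x := hx.1
      positivity
  refine exists_rep_Ioo₁ isAlgebraic_one h2 (fun x => (c : ℝ) / x) hc ?_
  refine isSemialgebraicFunOn_ratFun₁ ((KZ.isSemialgebraic_setOf_const_lt_apply isAlgebraic_one 0).inter
    (KZ.isSemialgebraic_setOf_apply_lt_const h2 0)) (C c) (X 0) (fun x => (c : ℝ) / x)
    (fun x hx => ?_) (fun x _ => ?_)
  · have : (1:ℝ) < x 0 := hx.1
    simpa using (show x 0 ≠ 0 by positivity)
  · simp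

/-- `[(0,1), 3/(2-r)]`, `[(0,1), 3/(1+r)]`, `[(0,1), 9/((2-r)(1+r))]` exist: rational integrands with
denominators positive on `(0,1)`. -/
theorem exists_ratRep01 (p q : MvPolynomial (Fin 1) ℚ) (f : ℝ → ℝ)
    (hq : ∀ r : ℝ, r ∈ Icc (0:ℝ) 1 → aeval (fun _ : Fin 1 => r) q ≠ 0)
    (hf : ∀ r : ℝ, f r = aeval (fun _ : Fin 1 => r) p / aeval (fun _ : Fin 1 => r) q)
    (hfc : ContinuousOn f (Icc 0 1)) :
    ∃ R : IntegralRep 1, R.domain = {x : Fin 1 → ℝ | 0 < x 0 ∧ x 0 < 1} ∧ R.integrand = fun x => f (x 0) := by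
  refine exists_rep_Ioo₁ isAlgebraic_zero isAlgebraic_one f hfc ?_
  have hx : ∀ x : Fin 1 → ℝ, (fun _ : Fin 1 => x 0) = x := fun x => by
    funext i; rw [Subsingleton.elim i 0]
  refine isSemialgebraicFunOn_ratFun₁ ((KZ.isSemialgebraic_setOf_const_lt_apply isAlgebraic_zero 0).inter
    (KZ.isSemialgebraic_setOf_apply_lt_const isAlgebraic_one 0)) p q f (fun x hx' => ?_) (fun x _ => ?_)
  · have h := hq (x 0) ⟨hx'.1.le, hx'.2.le⟩
    rwa [hx x] at h
  · have h := hf (x 0)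
    rwa [hx x] at h

/-! ## `[(0,1), 9/((2-r)(1+r))] ∼ [(1,2), 6/x]` -/

/-- `[(0,1), c/(2-r)] ∼ [(1,2), c/x]` by `x = 2 - r` (rule 2)). [Kontsevich–Zagier 2001, §1.2 rule (2)] -/
theorem twoSub_equivalent_L (c : ℝ) (R L : IntegralRep 1)
    (hRd : R.domain = {x : Fin 1 → ℝ | 0 < x 0 ∧ x 0 < 1})
    (hRi : EqOn R.integrand (fun x => c / (2 - x 0)) R.domain)
    (hLd : L.domain = {x : Fin 1 → ℝ | 1 < x 0 ∧ x 0 < 2})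
    (hLi : EqOn L.integrand (fun x => c / x 0) L.domain) : Equivalent R L := by
  have h2 : IsAlgebraic ℚ (2:ℝ) := by simpa using isAlgebraic_nat (R := ℚ) (A := ℝ) 2
  refine changeOfVariablesRel_subset_relations
    (of_sub_of_mem_changeOfVariablesRel_dimOne R L (fun r => 2 - r) (fun _ => -1) ?_ ?_ ?_ ?_ ?_)
  · have hX : IsSemialgebraicFunOn ℚ R.domain (fun z => z 0) :=
      (isSemialgebraicFunOn_aeval R.isSemialgebraic_domain (X 0 : MvPolynomial (Fin 1) ℚ)).congr
        fun z _ => by simp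
    exact (IsSemialgebraicFunOn.sub_holds
      (isSemialgebraicFunOn_const_of_isAlgebraic R.isSemialgebraic_domain h2) hX).congr
      fun p _ => by simp
  · intro p _
    simpa using (hasDerivAt_id' (p 0)).const_sub (2:ℝ)
  · intro p _ q _ h
    linarith
  · rw [hLd, hRd]
    ext x
    simp only [mem_setOf_eq, mem_image]
    constructor
    · rintro ⟨h1, h2'⟩
      exact ⟨fun _ => 2 - x 0, ⟨by linarith, by linarith⟩, funext fun i => by rw [Subsingleton.elim i 0]; ring⟩
    · rintro ⟨p, ⟨hp0, hp1⟩, rfl⟩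
      exact ⟨by show 1 < 2 - p 0; linarith, by show 2 - p 0 < 2; linarith⟩
  · intro p hp
    have hp' : 0 < p 0 ∧ p 0 < 1 := by rw [hRd] at hp; exact hp
    have hmem : (fun _ : Fin 1 => 2 - p 0) ∈ L.domain := by
      rw [hLd]; exact ⟨by show 1 < 2 - p 0; linarith, by show 2 - p 0 < 2; linarith⟩
    rw [hRi hp, hLi hmem]
    simp

/-- `[(0,1), c/(1+r)] ∼ [(1,2), c/x]` by `x = 1 + r` (rule 2)). [Kontsevich–Zagier 2001, §1.2 rule (2)] -/
theorem oneAdd_equivalent_L (c : ℝ) (R L : IntegralRep 1)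
    (hRd : R.domain = {x : Fin 1 → ℝ | 0 < x 0 ∧ x 0 < 1})
    (hRi : EqOn R.integrand (fun x => c / (1 + x 0)) R.domain)
    (hLd : L.domain = {x : Fin 1 → ℝ | 1 < x 0 ∧ x 0 < 2})
    (hLi : EqOn L.integrand (fun x => c / x 0) L.domain) : Equivalent R L := by
  refine changeOfVariablesRel_subset_relations
    (of_sub_of_mem_changeOfVariablesRel_dimOne R L (fun r => 1 + r) (fun _ => 1) ?_ ?_ ?_ ?_ ?_)
  · exact (isSemialgebraicFunOn_aeval R.isSemialgebraic_domain (1 + X 0 : MvPolynomial (Fin 1) ℚ)).congr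
      fun z _ => by simp
  · intro p _
    simpa using (hasDerivAt_id' (p 0)).const_add (1:ℝ)
  · intro p _ q _ h
    linarith
  · rw [hLd, hRd]
    ext x
    simp only [mem_setOf_eq, mem_image]
    constructor
    · rintro ⟨h1, h2'⟩
      exact ⟨fun _ => x 0 - 1, ⟨by linarith, by linarith⟩, funext fun i => by rw [Subsingleton.elim i 0]; ring⟩
    · rintro ⟨p, ⟨hp0, hp1⟩, rfl⟩
      exact ⟨by show 1 < 1 + p 0; linarith, by show 1 + p 0 < 2; linarith⟩
  · intro p hp
    have hp' : 0 < p 0 ∧ p 0 < 1 := by rw [hRd] at hp; exact hp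
    have hmem : (fun _ : Fin 1 => 1 + p 0) ∈ L.domain := by
      rw [hLd]; exact ⟨by show 1 < 1 + p 0; linarith, by show 1 + p 0 < 2; linarith⟩
    rw [hRi hp, hLi hmem]
    simp

/-- **The logarithmic tail** (blueprint v2, steps (M7)–(M8)): `[(0,1), 9/((2-r)(1+r))] ∼ [(1,2), 6/x]`
(`9∫₀¹ dr/((2-r)(1+r)) = 3[log((1+r)/(2-r))]₀¹ = 6 log 2 = ∫₁² 6dx/x`). Partial fractions (rule 1b)),
two substitutions onto `(1,2)` (rule 2)), and `3/x + 3/x = 6/x` (rule 1b)).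
[Kontsevich–Zagier 2001, §1.1–1.2] -/
theorem ratTail_equivalent_L6 (R L₆ : IntegralRep 1)
    (hRd : R.domain = {x : Fin 1 → ℝ | 0 < x 0 ∧ x 0 < 1})
    (hRi : EqOn R.integrand (fun x => 9 / ((2 - x 0) * (1 + x 0))) R.domain)
    (hLd : L₆.domain = {x : Fin 1 → ℝ | 1 < x 0 ∧ x 0 < 2})
    (hLi : EqOn L₆.integrand (fun x => 6 / x 0) L₆.domain) : Equivalent R L₆ := by
  -- the pieces
  obtain ⟨R₁, hR₁d, hR₁i⟩ := exists_ratRep01 (C 3) (C 2 - X 0) (fun r => 3 / (2 - r))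
    (fun r hr => by simp only [map_sub, MvPolynomial.aeval_C, MvPolynomial.aeval_X, eq_ratCast,
      Rat.cast_ofNat, ne_eq]; linarith [hr.2])
    (fun r => by simp)
    (continuousOn_const.div (by fun_prop) fun r hr => by
      have : (r:ℝ) ≤ 1 := hr.2
      exact ne_of_gt (by linarith))
  obtain ⟨R₂, hR₂d, hR₂i⟩ := exists_ratRep01 (C 3) (1 + X 0) (fun r => 3 / (1 + r))
    (fun r hr => by simp only [map_add, map_one, MvPolynomial.aeval_X, ne_eq]; linarith [hr.1])
    (fun r => by simp)
    (continuousOn_const.div (by fun_prop) fun r hr => by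
      have : (0:ℝ) ≤ r := hr.1
      exact ne_of_gt (by linarith))
  obtain ⟨L, hLd', hLi'⟩ := exists_L 3
  -- partial fractions
  have hsplit : of R - of R₁ - of R₂ ∈ relations := by
    refine integrandAddRel_subset_relations ⟨1, R, R₁, R₂, by rw [hR₁d, hRd], by rw [hR₂d, hRd],
      fun x hx => ?_, rfl⟩
    have hx' : 0 < x 0 ∧ x 0 < 1 := by rw [hRd] at hx; exact hx
    rw [hRi hx, Pi.add_apply, hR₁i, hR₂i]
    have h1 : (2 - x 0) ≠ 0 := by linarith [hx'.2]
    have h2 : (1 + x 0) ≠ 0 := by linarith [hx'.1]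
    field_simp
    ring
  -- the two substitutions
  have h₁ : Equivalent R₁ L := twoSub_equivalent_L 3 R₁ L hR₁d (fun x _ => by rw [hR₁i]) hLd'
    (fun x _ => by rw [hLi']; norm_num)
  have h₂ : Equivalent R₂ L := oneAdd_equivalent_L 3 R₂ L hR₂d (fun x _ => by rw [hR₂i]) hLd'
    (fun x _ => by rw [hLi']; norm_num)
  -- `3/x + 3/x = 6/x`
  have hmerge : of L₆ - of L - of L ∈ relations := by
    refine integrandAddRel_subset_relations ⟨1, L₆, L, L, by rw [hLd', hLd], by rw [hLd', hLd],
      fun x hx => ?_, rfl⟩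
    rw [hLi hx, Pi.add_apply, hLi']
    push_cast
    ring
  have e : of R - of L₆ = (of R - of R₁ - of R₂) + (of R₁ - of L) + (of R₂ - of L) - (of L₆ - of L - of L) := by
    abel
  show of R - of L₆ ∈ relations
  rw [e]
  exact relations.sub_mem (relations.add_mem (relations.add_mem hsplit h₁) h₂) hmerge

/-! ## `[(2,∞), 9/((v-1)(v+2))] ∼ [(0,1), 9/((2-r)(1+r))]` -/

/-- **Step (M6)→(M7)**: `[(2,∞), 9/((v-1)(v+2))] ∼ [(0,1), 9/((2-r)(1+r))]` by the substitution
`v = 2/r` from `(0,1)` onto `(2,∞)` (rule 2): `dv = 2dr/r²`, `(v-1)(v+2) = 2(2-r)(1+r)/r²`).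
[Kontsevich–Zagier 2001, §1.2 rule (2)] -/
theorem ratTail_equivalent_invTail (R W : IntegralRep 1)
    (hRd : R.domain = {x : Fin 1 → ℝ | 0 < x 0 ∧ x 0 < 1})
    (hRi : EqOn R.integrand (fun x => 9 / ((2 - x 0) * (1 + x 0))) R.domain)
    (hWd : W.domain = {x : Fin 1 → ℝ | 2 < x 0})
    (hWi : EqOn W.integrand (fun x => 9 / ((x 0 - 1) * (x 0 + 2))) W.domain) : Equivalent R W := by
  have h2 : IsAlgebraic ℚ (2:ℝ) := by simpa using isAlgebraic_nat (R := ℚ) (A := ℝ) 2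
  refine changeOfVariablesRel_subset_relations
    (of_sub_of_mem_changeOfVariablesRel_dimOne R W (fun r => 2 / r) (fun r => -(2 / r ^ 2)) ?_ ?_ ?_ ?_ ?_)
  · refine isSemialgebraicFunOn_ratFun₁ R.isSemialgebraic_domain (C 2) (X 0) (fun r => 2 / r)
      (fun x hx => ?_) (fun x _ => by simp)
    have hx' : 0 < x 0 ∧ x 0 < 1 := by rw [hRd] at hx; exact hx
    simpa using hx'.1.ne'
  · intro p hp
    have hp' : 0 < p 0 ∧ p 0 < 1 := by rw [hRd] at hp; exact hp
    have h := (hasDerivAt_inv hp'.1.ne').const_mul (2:ℝ)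
    refine (h.congr_deriv ?_).congr_of_eventuallyEq ?_
    · field_simp
    · exact Filter.Eventually.of_forall fun r => by simp [div_eq_mul_inv]
  · intro p hp q hq h
    have hp' : 0 < p 0 := by rw [hRd] at hp; exact hp.1
    have hq' : 0 < q 0 := by rw [hRd] at hq; exact hq.1
    have h' : (2 : ℝ) / p 0 = 2 / q 0 := h
    field_simp at h'
    linarith
  · rw [hWd, hRd]
    ext x
    simp only [mem_setOf_eq, mem_image]
    constructor
    · intro hx
      have hx0 : 0 < x 0 := by linarith
      refine ⟨fun _ => 2 / x 0, ⟨by positivity, ?_⟩, funext fun i => ?_⟩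
      · rw [div_lt_one hx0]; exact hx
      · rw [Subsingleton.elim i 0]
        field_simp
    · rintro ⟨p, ⟨hp0, hp1⟩, rfl⟩
      show 2 < 2 / p 0
      rw [lt_div_iff₀ hp0]
      linarith
  · intro p hp
    have hp' : 0 < p 0 ∧ p 0 < 1 := by rw [hRd] at hp; exact hp
    have hmem : (fun _ : Fin 1 => 2 / p 0) ∈ W.domain := by
      rw [hWd]
      show 2 < 2 / p 0
      rw [lt_div_iff₀ hp'.1]
      linarith
    rw [hRi hp, hWi hmem, abs_neg, abs_of_pos (by have := hp'.1; positivity)]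
    have h0 : p 0 ≠ 0 := hp'.1.ne'
    have h1 : (2 - p 0) ≠ 0 := by linarith [hp'.2]
    have h3 : (1 + p 0) ≠ 0 := by linarith [hp'.1]
    field_simp

end Summit.KontsevichZagierPeriods.KontsevichZagierPeriods.Theorems.GKZLevelThree

end
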